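import Summits.BirchSwinnertonDyer.Rank2.CertifiedPartnerTypeA
import HarnessLib

/-!
# Route `EisensteinDepletionAtTwo`, crux E1M `DepletedLambdaLawAtTwoMod` (stmt-BirchSwinnertonDyer-20341) —
# registered stub `stub_partnerCF_typeA` of line `cfsplit` (skeleton sha a2f9f4fe), CLOSED by name

Cell `bsd-rank2`, seat `bsd-rank2-eng-2` GEN 6 (`--supports stmt-BirchSwinnertonDyer-20341`). The stub (C_A) of
planner p2's line `cfsplit` v2.1/v2.2 asks, for every globally minimal `W`, good ordinary at `2`, with a unique
rational point of order `2` of abscissa `x` of Greenberg TYPE A («ramified at `2`, not odd»), for a certified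
partner `W′` in `W`'s own `2`-division field (`IsSquare (Δ_W·Δ_{W′})`, same type, unique rational `2`-torsion,
good ordinary at `2`) together with a ℚ-isogenous CF-habitat neighbour `W″ → W′` (good ordinary at `2`, a
Prop-5.14 point, three distinct rational `2`-torsion abscissae). This is EXACTLY the tree theorem
`Summit.BirchSwinnertonDyer.Rank2.exists_partnerCF_typeA` of seat `bsd-rank2-lit` GEN 18
(`Rank2/CertifiedPartnerTypeA.lean`, with `…TypeAModelOne/Three`, `…TypeANeighbourOne/Three/Isogeny`,
`…TypeATorsion`: the explicit families `W′_i` for `D = 4i+1`, `4i+3` and their full-`2`-torsion neighbours); the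
type-B half is `Rank2.exists_partnerCF_typeB` and is used by name in the line's composition
`CfSplit.DepletedLambdaLawAtTwoMod_of`. This file states the stub token for token as registered and closes it by
`exact` (the A ∨ B form of the v2.0 registration is lit's `Rank2.exists_partnerCF`). THEOREMS ONLY (no definition, no named fact, no `sorry`).

PARTITION: none — r_an ≥ 2, summit axis S0 (D-0036(1) funded rung); TWIN (D-0056): n/a. B1 honesty:
explicit-model algebra by name; nothing here reads an analytic rank; no S0 motion.
-/

set_option autoImplicit false
-- the Theorems namespace of a single-conjunct summit repeats the summit name by design (D-0017)
set_option linter.dupNamespace false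

noncomputable section

open Literature.NumberTheory.EllipticCurves Literature.NumberTheory.EllipticCurves.Greenberg1999

namespace Summit.BirchSwinnertonDyer.BirchSwinnertonDyer.Theorems.EisensteinDepletionAtTwoStubPartnerCFTypeA

/-- **STUB (C_A) `stub_partnerCF_typeA` of line `cfsplit` (crux E1M `DepletedLambdaLawAtTwoMod`,
stmt-BirchSwinnertonDyer-20341), registered signature token for token — certified partner + CF-habitat
neighbour in the curve's own `2`-division field, TYPE-A input.** Closed by the tree theorem
`Rank2.exists_partnerCF_typeA` (bsd-rank2-lit GEN 18). [folklore] -/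
theorem stub_partnerCF_typeA :
    ∀ (W : WeierstrassCurve ℚ) [W.IsElliptic] [W.IsGloballyMinimal] (x : ℚ), IsOrdinaryAt W 2 →
      HasUniqueRationalTwoTorsionX W x → TwoTorsionRamifiedAtTwo x ∧ ¬ TwoTorsionOdd W x →
      ∃ (W' : WeierstrassCurve ℚ) (_ : W'.IsElliptic) (_ : W'.IsGloballyMinimal) (x' : ℚ),
        IsOrdinaryAt W' 2 ∧ HasUniqueRationalTwoTorsionX W' x' ∧ SameGreenbergTypeAB W x W' x' ∧
          IsSquare (W.Δ * W'.Δ) ∧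
          ∃ (W'' : WeierstrassCurve ℚ) (_ : W''.IsElliptic) (_ : W''.IsGloballyMinimal),
            WeierstrassCurve.IsIsogenous W'' W' ∧ IsOrdinaryAt W'' 2 ∧
              (∃ x₀ y₀ : ℚ, W''.toAffine.Equation x₀ y₀ ∧ 2 * y₀ + W''.a₁ * x₀ + W''.a₃ = 0 ∧
                ((TwoTorsionRamifiedAtTwo x₀ ∧ ¬ TwoTorsionOdd W'' x₀) ∨
                  (TwoTorsionOdd W'' x₀ ∧ ¬ TwoTorsionRamifiedAtTwo x₀))) ∧
              (∃ x₁ x₂ x₃ : ℚ, x₁ ≠ x₂ ∧ x₁ ≠ x₃ ∧ x₂ ≠ x₃ ∧ HasRationalTwoTorsionX W'' x₁ ∧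
                HasRationalTwoTorsionX W'' x₂ ∧ HasRationalTwoTorsionX W'' x₃) :=
  fun W _ _ x hord hx hA ↦ Summit.BirchSwinnertonDyer.Rank2.exists_partnerCF_typeA W x hord hx hA

end Summit.BirchSwinnertonDyer.BirchSwinnertonDyer.Theorems.EisensteinDepletionAtTwoStubPartnerCFTypeA

end
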